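/-
Copyright (c) 2026 the pub-hodgecm-mathlib formalisation cell (harness21).  Prover seat hodgecm-mathlib-F0P3a-p05 (g17): road «S3-ram» (LEAD F0P3a-plan (g12∕g13); owner∕table
F0P3a-p06 (g15)), the (a2) JUNCTION (J★) of F0P3a-p01 (g17): sockets `row_oneClassTrans` (ROW-1C-TRANS) and `row_signDict` (SGN-DICT) of skeleton v7 326c2913 (dealt
2026-09-02T01:50:26Z); 2026-09-02.
-/
import Literature.NumberTheory.Automorphic.UnitaryLatticeTreeRankOneVertexOneClassRamified   -- ★ p847514 + ED. 2 p847595 (this seat): ROW-1C — §1 residual rank-one kit (`exists_forall_represents_iff_of_symm_of_mul_self_eq_zero`), §2 dictionary (`exists_mem_stdLattice_depthClass_iff_residue`, `exists_mem_mapGL_stdLattice_depthClass_iff`), ★ G3⁗ `exists_unit_v_sub_mul_sq_lt_one_iff_residue`, Mathlib `quadraticChar`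
import HarnessLib

/-!
# The lattice graph of a hermitian space — THE CLASS CONSTANT DICTIONARY of the (a2) junction: two classes represented at a rank-one vertex differ by a unit square
# (ROW-1C-TRANS), and `χ(−1)` as a unit-square dictionary `−c ∈ c·□ ∕ cε·□` (SGN-DICT) (Rogawski 1990 §4.9; Kottwitz 1986 §3; Ireland–Rosen Ch. 5)

Topic `NumberTheory/Automorphic`; namespace `Literature.NumberTheory.Automorphic.UnitaryLatticeTree`.  THEOREMS ONLY (no definition, no instance, no notation, no named fact,
no `sorry`); kernel lane `--supports stmt-HodgeConjecture-24833`; datum as in ★ ROW-1C (`σ` valuation-preserving involution, `σϖ = −ϖ`, residually trivial, `|2| = 1`, finite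
`𝓀`).  Cell `pub/hodgecm-mathlib` (D-0151), crux H413; road «S3-ram» (Literature seeding, count-neutral), organ A′e, the JUNCTION (J★) `stub_signedStrataCount_typeOne_ram`
(F0P3a-p01 (g16∕g17)).  Skeleton v7 (`F0/P3a/F0P3a-p01/g17/junction/JunctionSockets.skeleton.v7.F0P3ap01g17.lean`, 326c2913) deals two small sockets to this seat
(junction pen 2026-09-02T01:50:26Z (5)): **ROW-1C-TRANS** `row_oneClassTrans` :383 (the L4 `rootData_of_rows` consumer: two class constants represented at the same
rank-one vertex differ by a unit square) and **SGN-DICT** `row_signDict` :396 («−c ∈ c□ iff −1 ∈ □, else −c ∈ cε□ and −cε ∈ c□» as three unit-lift clauses).  THIS FILE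
closes both, binder for binder (§2's `hγ0 hfix hnil ε hεv hε` and §3's `hϖ h2` are carried, unused).

THE MATHEMATICS.  (ROW-1C-TRANS) As in ★ ROW-1C: `w = u·L₀`, `Y = u⁻¹γu − 1`, the residual leading matrix `Ȳ` is `J₀`-symmetric, non-zero, of square zero, so its quadratic
form is `x̄ ↦ ℓ(x̄)²∕s₀` and a non-zero class `t·(𝓀ˣ)²` is represented iff `s₀t` is a non-zero square (★ `exists_forall_represents_iff_of_symm_of_mul_self_eq_zero`); if `c` and
`c′` are both represented, `s₀c̄ = z₁²`, `s₀c̄′ = z₂²`, so `c̄′ = c̄·(z₂∕z₁)²`, and ★ `exists_unit_v_sub_mul_sq_lt_one_iff_residue` lifts this to `|c′ − c·z²| < 1` with a unit `z`.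
(SGN-DICT) In the finite field `𝓀`: if `−1 = r²` then `−c̄ = c̄·r²`; if `−1` is not a square then (as `ε̄` is not one either, and the product of two non-squares is a square —
`quadraticChar` is multiplicative) `−ε̄ = b²`, whence `−c̄ = c̄ε̄·(b∕ε̄)²` and `−c̄ε̄ = c̄·b²`; lift each residue identity to a unit `z` by the same ★ dictionary.
HONEST LABEL: HC_CM is proved only modulo the 2 remaining named inputs (hLiu418 24832, h413 24833) until rung 0 closes; nothing printed is asserted here (bookkeeping).

* §1 **`exists_unit_sub_mul_sq_lt_one_stdLattice_of_rankOne`** (matrix form at `L₀`).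
* §2 **`exists_unit_sub_mul_sq_lt_one_of_fixed_selfDual_rankOne`** (= socket `row_oneClassTrans`).
* §3 **`signDict_of_residue_nonsquare`** (= socket `row_signDict`).

## References
* [Rogawski1990] J. D. Rogawski, *Automorphic Representations of Unitary Groups in Three Variables*, Ann. of Math. Stud. 123 (1990), §4.9 pp. 54–55 (the two rank-one classes).
* [Kottwitz1986] R. E. Kottwitz, *Base change for unit elements of Hecke algebras*, Compositio Math. 60 (1986), §3.
* [Tits1979] J. Tits, *Reductive groups over local fields*, PSPM 33.1 (1979), §3.5.
* [IrelandRosen1990] K. Ireland, M. Rosen, *A Classical Introduction to Modern Number Theory*, 2nd ed. (1990), Ch. 5 §1 (quadratic residues in a finite field; `χ` multiplicative).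
-/

set_option autoImplicit false

noncomputable section

open scoped Valued WithZero Matrix MatrixGroups

namespace Literature.NumberTheory.Automorphic.UnitaryLatticeTree

open Literature.NumberTheory.Automorphic Literature.NumberTheory.Automorphic.HermitianLattice

variable {K : Type*} [Field K] [Valued K ℤᵐ⁰] {σ : K →+* K} {ϖ : K}

/-! ## §1 ROW-1C-TRANS at the root (matrix form): two represented unit classes differ by a unit square -/

/-- **TWO CLASSES REPRESENTED AT A RANK-ONE ELEMENT DIFFER BY A UNIT SQUARE (matrix form at `L₀`).**  For `γ ∈ U(σ, J₀)`, `Y = γ − 1` with `|Y_{ij}| ≤ |ϖ|^d` (`d ≥ 1`), NOT all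
`≤ |ϖ|^{d+1}`, `|(Y²)_{ij}| ≤ |ϖ|^{2d+1}`, and units `c, c′` both taken by `x ↦ ϖ^{−d}·B₀(x, Yx)` on `𝒪³` to first order: `|c′ − c·z²| < 1` for some unit `z` (the residual form is
`λ·ℓ²`: ★ `exists_forall_represents_iff_of_symm_of_mul_self_eq_zero`). [cite: Rogawski1990, §4.9 p. 55] [cite: Kottwitz1986, §3] [cite: Tits1979, §3.5] -/
theorem exists_unit_sub_mul_sq_lt_one_stdLattice_of_rankOne (hvσ : ∀ a, Valued.v (σ a) = Valued.v a) (hσϖ : σ ϖ = -ϖ)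
    (hϖ : Valued.v ϖ = WithZero.exp (-1 : ℤ)) (hres : ∀ x : K, Valued.v x ≤ 1 → Valued.v (σ x - x) < 1) (h2 : Valued.v (2 : K) = 1)
    (γ : unitaryGroupOfForm σ ((StdForm.antidiagonal 3).over K)) {d : ℕ} (hd1 : 1 ≤ d)
    (hY : ∀ i j, Valued.v ((((γ : GL (Fin 3) K) : Matrix (Fin 3) (Fin 3) K) - 1) i j) ≤ Valued.v ϖ ^ d)
    (hY' : ¬ ∀ i j, Valued.v ((((γ : GL (Fin 3) K) : Matrix (Fin 3) (Fin 3) K) - 1) i j) ≤ Valued.v ϖ ^ (d + 1))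
    (hsq : ∀ i j, Valued.v (((((γ : GL (Fin 3) K) : Matrix (Fin 3) (Fin 3) K) - 1) * ((((γ : GL (Fin 3) K) : Matrix (Fin 3) (Fin 3) K) - 1))) i j) ≤ Valued.v ϖ ^ (2 * d + 1))
    (c c' : K) (hc : Valued.v c = 1) (hc' : Valued.v c' = 1)
    (h₁ : ∃ x ∈ stdLattice K 3, ∃ a : K, Valued.v a = 1 ∧
      Valued.v ((ϖ ^ d)⁻¹ * pairing σ ((StdForm.antidiagonal 3).over K) x ((((γ : GL (Fin 3) K) : Matrix (Fin 3) (Fin 3) K) - 1) *ᵥ x) - c * a ^ 2) < 1)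
    (h₂ : ∃ x ∈ stdLattice K 3, ∃ a : K, Valued.v a = 1 ∧
      Valued.v ((ϖ ^ d)⁻¹ * pairing σ ((StdForm.antidiagonal 3).over K) x ((((γ : GL (Fin 3) K) : Matrix (Fin 3) (Fin 3) K) - 1) *ᵥ x) - c' * a ^ 2) < 1) :
    ∃ z : K, Valued.v z = 1 ∧ Valued.v (c' - c * z ^ 2) < 1 := by
  set Y : Matrix (Fin 3) (Fin 3) K := ((γ : GL (Fin 3) K) : Matrix (Fin 3) (Fin 3) K) - 1 with hYdef
  have hodd : Odd d := by
    rcases Nat.even_or_odd d with hev | hodd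
    · exact absurd (forall_v_coe_sub_one_le_succ_of_even_of_sq_le hvσ hσϖ hϖ hres h2 γ hev hd1 hY hsq) hY'
    · exact hodd
  obtain ⟨Y₀, hY₀⟩ := exists_integer_matrix_eq_inv_pow_mul hϖ Y hY
  have hsymm : ∀ i j, Y₀.map (IsLocalRing.residue 𝒪[K]) i j = Y₀.map (IsLocalRing.residue 𝒪[K]) j.rev i.rev :=
    map_residue_apply_eq_rev_of_sub_le hϖ Y Y₀ hY₀ (v_coe_sub_one_apply_sub_rev_le_of_odd hvσ hσϖ hϖ hres γ hodd hY)
  have hsq0 := map_residue_mul_self_eq_zero_of_sq_le hϖ Y Y₀ hY₀ hsq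
  have hne0 := map_residue_ne_zero_of_not_forall_le_succ hϖ Y Y₀ hY₀ hY'
  obtain ⟨s₀, hs₀, hrep⟩ := exists_forall_represents_iff_of_symm_of_mul_self_eq_zero (Y₀.map (IsLocalRing.residue 𝒪[K])) hsymm hsq0 hne0
  have hc0 : IsLocalRing.residue 𝒪[K] ⟨c, (Valuation.mem_integer_iff _ _).2 hc.le⟩ ≠ 0 := by
    rw [Ne, residue_eq_zero_iff_v_lt_one]; exact fun h => (ne_of_lt h) hc
  have hc0' : IsLocalRing.residue 𝒪[K] ⟨c', (Valuation.mem_integer_iff _ _).2 hc'.le⟩ ≠ 0 := by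
    rw [Ne, residue_eq_zero_iff_v_lt_one]; exact fun h => (ne_of_lt h) hc'
  obtain ⟨z₁, hz₁, h1⟩ := ((hrep _ hc0).1 ((exists_mem_stdLattice_depthClass_iff_residue hvσ hres hϖ Y Y₀ hY₀ c hc.le).1 h₁))
  obtain ⟨z₂, hz₂, h2'⟩ := ((hrep _ hc0').1 ((exists_mem_stdLattice_depthClass_iff_residue hvσ hres hϖ Y Y₀ hY₀ c' hc'.le).1 h₂))
  -- `c̄′ = c̄·(z₂∕z₁)²`
  have key : IsLocalRing.residue 𝒪[K] ⟨c', (Valuation.mem_integer_iff _ _).2 hc'.le⟩ =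
      IsLocalRing.residue 𝒪[K] ⟨c, (Valuation.mem_integer_iff _ _).2 hc.le⟩ * (z₂ / z₁) ^ 2 := by
    have e1 : IsLocalRing.residue 𝒪[K] ⟨c, (Valuation.mem_integer_iff _ _).2 hc.le⟩ = z₁ ^ 2 / s₀ := by
      rw [eq_div_iff hs₀, mul_comm]; exact h1
    have e2 : IsLocalRing.residue 𝒪[K] ⟨c', (Valuation.mem_integer_iff _ _).2 hc'.le⟩ = z₂ ^ 2 / s₀ := by
      rw [eq_div_iff hs₀, mul_comm]; exact h2'
    rw [e1, e2]
    field_simp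
  exact (exists_unit_v_sub_mul_sq_lt_one_iff_residue ⟨c', (Valuation.mem_integer_iff _ _).2 hc'.le⟩ ⟨c, (Valuation.mem_integer_iff _ _).2 hc.le⟩).2
    ⟨z₂ / z₁, div_ne_zero hz₂ hz₁, key⟩

/-! ## §2 ROW-1C-TRANS at a vertex (the junction socket `row_oneClassTrans`) -/

/-- **ROW-1C-TRANS «ONE CLASS: transitivity form»** (= junction socket `row_oneClassTrans`, skeleton v7 326c2913 :383, binder for binder; its `hγ0 hfix hnil ε hεv hε` are
carried, unused): at a `γ`-fixed self-dual vertex of exact depth `d ≥ 1` and rank one, two represented class constants differ by a unit square. [cite: Rogawski1990, §4.9 p. 55]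
[cite: Kottwitz1986, §3] [cite: Tits1979, §3.5] -/
theorem exists_unit_sub_mul_sq_lt_one_of_fixed_selfDual_rankOne (hσ : ∀ x, σ (σ x) = x) (hvσ : ∀ a, Valued.v (σ a) = Valued.v a) (hσϖ : σ ϖ = -ϖ)
    (hϖ : Valued.v ϖ = WithZero.exp (-1 : ℤ)) (hres : ∀ x : K, Valued.v x ≤ 1 → Valued.v (σ x - x) < 1) (h2 : Valued.v (2 : K) = 1) [Finite 𝓀[K]]
    {γ : unitaryGroupOfForm σ ((StdForm.antidiagonal 3).over K)} (_hγ0 : γ ∈ unitaryInt σ ((StdForm.antidiagonal 3).over K))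
    {w : {M : Submodule 𝒪[K] (Fin 3 → K) // IsVertex σ ϖ ((StdForm.antidiagonal 3).over K) M}} (hw : IsSelfDualLattice σ ϖ ((StdForm.antidiagonal 3).over K) w.1) (_hfix : latticeGraphIso σ ϖ ((StdForm.antidiagonal 3).over K) γ w = w)
    {d : ℕ} (hd1 : 1 ≤ d)
    (hlev : w.1.map ((Matrix.toLin' (((γ : GL (Fin 3) K) : Matrix (Fin 3) (Fin 3) K) - 1)).restrictScalars 𝒪[K]) ≤ scaleLattice (ϖ ^ d) w.1) (hlev' : ¬ w.1.map ((Matrix.toLin' (((γ : GL (Fin 3) K) : Matrix (Fin 3) (Fin 3) K) - 1)).restrictScalars 𝒪[K]) ≤ scaleLattice (ϖ ^ (d + 1)) w.1) (hrk : w.1.map ((Matrix.toLin' ((((γ : GL (Fin 3) K) : Matrix (Fin 3) (Fin 3) K) - 1) ^ 2)).restrictScalars 𝒪[K]) ≤ scaleLattice (ϖ ^ (2 * d + 1)) w.1) (_hnil : w.1.map ((Matrix.toLin' ((((γ : GL (Fin 3) K) : Matrix (Fin 3) (Fin 3) K) - 1) ^ 3)).restrictScalars 𝒪[K]) ≤ scaleLattice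 (ϖ ^ (3 * d + 1)) w.1)
    (c c' ε : K) (hc : Valued.v c = 1) (hc' : Valued.v c' = 1) (_hεv : Valued.v ε = 1) (_hε : ∀ z : K, Valued.v z ≤ 1 → Valued.v (z ^ 2 - ε) = 1)
    (h₁ : ∃ y ∈ w.1, ∃ a : K, Valued.v a = 1 ∧ Valued.v ((ϖ ^ (d))⁻¹ * pairing σ ((StdForm.antidiagonal 3).over K) y ((((γ : GL (Fin 3) K) : Matrix (Fin 3) (Fin 3) K) - 1) *ᵥ y) - (c) * a ^ 2) < 1) (h₂ : ∃ y ∈ w.1, ∃ a : K, Valued.v a = 1 ∧ Valued.v ((ϖ ^ (d))⁻¹ * pairing σ ((StdForm.antidiagonal 3).over K) y ((((γ : GL (Fin 3) K) : Matrix (Fin 3) (Fin 3) K) - 1) *ᵥ y) - (c') * a ^ 2) < 1) :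
    ∃ z : K, Valued.v z = 1 ∧ Valued.v (c' - c * z ^ 2) < 1 := by
  have hϖ0 : ϖ ≠ 0 := fun h0 => by rw [h0, map_zero] at hϖ; exact WithZero.coe_ne_zero hϖ.symm
  obtain ⟨u, hu⟩ := exists_latticeGraphIso_root_eq_of_v_two hσ hvσ hϖ h2 w hw (isSelfDualLattice_stdLattice_three_of_v hϖ)
  subst hu
  have hY : ∀ i j, Valued.v (((((u⁻¹ * γ * u : unitaryGroupOfForm σ ((StdForm.antidiagonal 3).over K)) : GL (Fin 3) K) : Matrix (Fin 3) (Fin 3) K) - 1) i j) ≤ Valued.v ϖ ^ d :=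
    fun i j => by rw [← map_pow]; exact (forall_v_conj_sub_one_le_iff_map_sub_one_le_scaleLattice γ u (pow_ne_zero _ hϖ0)).1 hlev i j
  have hY' : ¬ ∀ i j, Valued.v (((((u⁻¹ * γ * u : unitaryGroupOfForm σ ((StdForm.antidiagonal 3).over K)) : GL (Fin 3) K) : Matrix (Fin 3) (Fin 3) K) - 1) i j) ≤ Valued.v ϖ ^ (d + 1) :=
    fun h => hlev' ((forall_v_conj_sub_one_le_iff_map_sub_one_le_scaleLattice γ u (pow_ne_zero _ hϖ0)).2 fun i j => by rw [map_pow]; exact h i j)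
  have hu' : IsUnit ((u : GL (Fin 3) K) : Matrix (Fin 3) (Fin 3) K).det := Matrix.isUnits_det_units _
  have hconj : ((u : GL (Fin 3) K) : Matrix (Fin 3) (Fin 3) K)⁻¹ * (((γ : GL (Fin 3) K) : Matrix (Fin 3) (Fin 3) K) - 1) * ((u : GL (Fin 3) K) : Matrix (Fin 3) (Fin 3) K) =
      (((u⁻¹ * γ * u : unitaryGroupOfForm σ ((StdForm.antidiagonal 3).over K)) : GL (Fin 3) K) : Matrix (Fin 3) (Fin 3) K) - 1 := by
    rw [coe_inv_mul_mul_sub_one, Matrix.coe_units_inv]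
  have hrk' : (latt ((u : GL (Fin 3) K) : Matrix (Fin 3) (Fin 3) K)).map ((Matrix.toLin' ((((γ : GL (Fin 3) K) : Matrix (Fin 3) (Fin 3) K) - 1) ^ 2)).restrictScalars 𝒪[K]) ≤
      scaleLattice (ϖ ^ (2 * d + 1)) (latt ((u : GL (Fin 3) K) : Matrix (Fin 3) (Fin 3) K)) := hrk
  rw [map_toLin'_latt_le_scaleLattice_iff (pow_ne_zero _ hϖ0) _ hu', inv_mul_sq_mul_eq_sq _ hu', hconj] at hrk'
  have hsq : ∀ i j, Valued.v ((((((u⁻¹ * γ * u : unitaryGroupOfForm σ ((StdForm.antidiagonal 3).over K)) : GL (Fin 3) K) : Matrix (Fin 3) (Fin 3) K) - 1) *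
      ((((u⁻¹ * γ * u : unitaryGroupOfForm σ ((StdForm.antidiagonal 3).over K)) : GL (Fin 3) K) : Matrix (Fin 3) (Fin 3) K) - 1)) i j) ≤ Valued.v ϖ ^ (2 * d + 1) :=
    fun i j => by rw [← pow_two, ← map_pow]; exact hrk' i j
  have hw1 : (latticeGraphIso σ ϖ ((StdForm.antidiagonal 3).over K) u ⟨stdLattice K 3, 0, isSelfDualLattice_stdLattice_three_of_v hϖ⟩).1 =
      mapGL (u : GL (Fin 3) K) (stdLattice K 3) := rfl
  rw [hw1, exists_mem_mapGL_stdLattice_depthClass_iff u γ ((ϖ ^ d)⁻¹) c] at h₁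
  rw [hw1, exists_mem_mapGL_stdLattice_depthClass_iff u γ ((ϖ ^ d)⁻¹) c'] at h₂
  exact exists_unit_sub_mul_sq_lt_one_stdLattice_of_rankOne hvσ hσϖ hϖ hres h2 (u⁻¹ * γ * u) hd1 hY hY' hsq c c' hc hc' h₁ h₂

/-! ## §3 SGN-DICT (the junction socket `row_signDict`) -/

/-- **SGN-DICT «χ(−1) AS A UNIT-SQUARE DICTIONARY»** (= junction socket `row_signDict`, skeleton v7 :396, binder for binder; `hϖ h2` carried, unused): for a unit `c` and a
residual non-square unit `ε`: if `−1` is a residue square then `−c ∈ c·□`; otherwise `−c ∈ cε·□` and `−cε ∈ c·□` (in a finite field the product of two non-squares is a square;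
lift by ★ `exists_unit_v_sub_mul_sq_lt_one_iff_residue`). [cite: Rogawski1990, §4.9 p. 55] [cite: IrelandRosen1990, Ch. 5 §1] -/
theorem signDict_of_residue_nonsquare (_hϖ : Valued.v ϖ = WithZero.exp (-1 : ℤ)) (_h2 : Valued.v (2 : K) = 1) [Finite 𝓀[K]]
    (ε : K) (hεv : Valued.v ε = 1) (hε : ∀ z : K, Valued.v z ≤ 1 → Valued.v (z ^ 2 - ε) = 1)
    (c : K) (hc : Valued.v c = 1) :
    (IsSquare (-1 : 𝓀[K]) → ∃ z : K, Valued.v z = 1 ∧ Valued.v (-c - c * z ^ 2) < 1) ∧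
      (¬ IsSquare (-1 : 𝓀[K]) → ∃ z : K, Valued.v z = 1 ∧ Valued.v (-c - c * ε * z ^ 2) < 1) ∧
      (¬ IsSquare (-1 : 𝓀[K]) → ∃ z : K, Valued.v z = 1 ∧ Valued.v (-(c * ε) - c * z ^ 2) < 1) := by
  classical
  haveI : Fintype 𝓀[K] := Fintype.ofFinite _
  -- the integers `c`, `−c`, `cε`, `−(cε)` and the residues
  have hcε : Valued.v (c * ε) ≤ 1 := by rw [map_mul, hc, hεv, one_mul]
  set cO : 𝒪[K] := ⟨c, (Valuation.mem_integer_iff _ _).2 hc.le⟩ with hcO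
  set εO : 𝒪[K] := ⟨ε, (Valuation.mem_integer_iff _ _).2 hεv.le⟩ with hεO
  have hε0 : IsLocalRing.residue 𝒪[K] εO ≠ 0 := by
    rw [Ne, residue_eq_zero_iff_v_lt_one]; exact fun h => (ne_of_lt h) hεv
  have hεns : ¬ IsSquare (IsLocalRing.residue 𝒪[K] εO) := by
    rintro ⟨r, hr⟩
    obtain ⟨z, rfl⟩ := IsLocalRing.residue_surjective r
    have h1 := hε z z.2
    have h0 : IsLocalRing.residue 𝒪[K] (z ^ 2 - εO) = 0 := by rw [map_sub, map_pow, hr, pow_two, sub_self]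
    rw [residue_eq_zero_iff_v_lt_one] at h0
    push_cast at h0
    exact (ne_of_lt h0) h1
  have hχε : quadraticChar 𝓀[K] (IsLocalRing.residue 𝒪[K] εO) = -1 := (quadraticChar_neg_one_iff_not_isSquare).2 hεns
  -- the unit-lift dictionary (★ G3⁗): `|t − s·z²| < 1` for a unit `z` iff `t̄ = s̄·ā²`, `ā ≠ 0`
  have lift : ∀ (t s : 𝒪[K]) (a : 𝓀[K]), a ≠ 0 → IsLocalRing.residue 𝒪[K] t = IsLocalRing.residue 𝒪[K] s * a ^ 2 →
      ∃ z : K, Valued.v z = 1 ∧ Valued.v ((t : K) - (s : K) * z ^ 2) < 1 :=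
    fun t s a ha h => (exists_unit_v_sub_mul_sq_lt_one_iff_residue t s).2 ⟨a, ha, h⟩
  refine ⟨fun hsq => ?_, fun hns => ?_, fun hns => ?_⟩
  · -- `−1 = r²`: `−c = c·r²`
    obtain ⟨r, hr⟩ := hsq
    have hr0 : r ≠ 0 := fun h => by rw [h, mul_zero] at hr; exact neg_ne_zero.2 one_ne_zero hr
    obtain ⟨z, hz, hlt⟩ := lift (-cO) cO r hr0 (by rw [map_neg, pow_two, ← hr]; ring)
    exact ⟨z, hz, by simpa using hlt⟩
  · -- `−1`, `ε` non-squares ⇒ `−ε = b²`; `−c = cε·(b∕ε)²`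
    have hsqq : IsSquare (-(IsLocalRing.residue 𝒪[K] εO)) := by
      have hne : -(IsLocalRing.residue 𝒪[K] εO) ≠ 0 := neg_ne_zero.2 hε0
      rw [← quadraticChar_one_iff_isSquare hne, neg_eq_neg_one_mul, map_mul, hχε, (quadraticChar_neg_one_iff_not_isSquare).2 hns]
      norm_num
    obtain ⟨b, hb⟩ := hsqq
    have hb0 : b ≠ 0 := fun h => by rw [h, mul_zero] at hb; exact (neg_ne_zero.2 hε0) hb
    obtain ⟨z, hz, hlt⟩ := lift (-cO) (cO * εO) (b * (IsLocalRing.residue 𝒪[K] εO)⁻¹) (mul_ne_zero hb0 (inv_ne_zero hε0)) (by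
      rw [map_neg, map_mul, mul_pow, inv_pow, pow_two b, ← hb]
      field_simp)
    exact ⟨z, hz, by simpa using hlt⟩
  · -- `−(cε) = c·b²` with `b² = −ε`
    have hsqq : IsSquare (-(IsLocalRing.residue 𝒪[K] εO)) := by
      have hne : -(IsLocalRing.residue 𝒪[K] εO) ≠ 0 := neg_ne_zero.2 hε0
      rw [← quadraticChar_one_iff_isSquare hne, neg_eq_neg_one_mul, map_mul, hχε, (quadraticChar_neg_one_iff_not_isSquare).2 hns]
      norm_num
    obtain ⟨b, hb⟩ := hsqq
    have hb0 : b ≠ 0 := fun h => by rw [h, mul_zero] at hb; exact (neg_ne_zero.2 hε0) hb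
    obtain ⟨z, hz, hlt⟩ := lift (-(cO * εO)) cO b hb0 (by rw [map_neg, map_mul, pow_two, ← hb, mul_neg])
    exact ⟨z, hz, by simpa using hlt⟩

end Literature.NumberTheory.Automorphic.UnitaryLatticeTree

end
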